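/-
Copyright (c) 2026 the pub-hodgecm-mathlib formalisation cell (harness21).  Prover seat hodgecm-mathlib-LH4-p04 (g3), req620 Track A «(D-RAM) FOUR-FRAME» squad
(unit U2H_HSide, the (ρ2b′-X) payer road of LH4-p14 (g3) (RHO2BX-ORDER v1, organ O-Sum ∕ T5s «TORIC CENSUS SUM», TYPE U); dealer∕pen LH4-plan (g12) WORD #21∕#22, LH4-p14 (g3)
04:08Z hand-over; letters of record = LH4-p08 (g4) T5a sheet v3 via LH4-p10 (g3)'s socket read 04:13Z (a)(b)(c); inputs E1 v1 (F0P3a-p01 (g32)) ∕ p14's frozen census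
`osum_typeU_identity.v2` fa1812e2; REF5 (g23) R5-152 Lean-semantics read (7 760 tuples).  2026-09-04.
-/
import Summits.HodgeConjecture.HodgeConjecture.Theorems.F0P3cDyRamToricCensusSumUnrParts   -- FILE 2 (this seat): `sumP_eval`, `sumM_eval`, `algebra_pos`, `algebra_neg`; brings FILE 1
import HarnessLib

/-!
# Crux `H413`, line LH4 «(D-RAM) FOUR-FRAME» road — unit U2H (ii-H), the (ρ2b′-X) payer: O-Sum ∕ T5s «TORIC CENSUS SUM», TYPE U — FILE 3∕3 «THE IDENTITY»:
# `ε·Σ_{j ≤ jl} Σ_a q^a (dep₊(j,a) − dep₋(j,a)) = q^m·(N_V(n_H) − 2[S]_q)` on the realizable token set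

Cell `hodgecm-mathlib` (D-0151), FLOOR 0, crux item H413 = `stmt-HodgeConjecture-24833`, route of record `HCCMUnconditional`; squad F0∕P3c∕LH4 (req618∕req620); registered stub
served: `F0P3cDyRamFourFrameU2H.stub_U2H_fixedPointCensus_typeTwo_unit0` ((ρ2b′-X), tree `Cruxes/H413/Lines/F0_P3c_DyRamFourFrame_U2H_HSide.lean` ED. 15 :418), organ O-Sum ∕
T5s of LH4-p14 (g3)'s RHO2BX-ORDER v1 §B, consumed by the ★ spine's `hOrg` (p857277) through the T6 head (type U = `K∕F` unramified; types RamK ∕ RamM are sibling files once E1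
v2∕v3 freeze their level tables).  THEOREMS ONLY (no `def`, no instance, no notation, no `sorry`, default heartbeats); lane `--supports stmt-HodgeConjecture-24833 --as helper`.

THE STATEMENT (HEAD BYTES posted first, κ-BOX-SUM discipline; cell families = LH4-p08 (g4)'s T5a sheet v3 letters token for token per LH4-p10 (g3)'s socket read 04:13Z
((a) exponent `j − 2 − (j−a−d)∕2`, (b) parity token `(j + d) % 2 = 0`, (c) ε-FREE TOP BITS `d + m ≤ jl ∧ j < jl` ∕ `jl + 1 = d + m ∧ j < jl`) = LH4-p14 (g3)'s frozen census
`osum_typeU_identity.v2` fa1812e2; validated `validate_head.v2` 4c70440a67a4e659: 500∕500 realizable tuples `q ≤ 5`, `2 ≤ d ≤ 7`, `jl ≤ 14`, LHS ≡ p14's `ε·(N₊ − N₋)` on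
500∕500; REF5 (g23) R5-152 independent Lean-semantics read: 7 760 tuples, 0 mismatches).  Function symbols `nP nM` (the u-FREE LEVEL TABLES of E1 v1 §B, closed forms of group
indices `G j = |(𝒪_M∕ϖ^j)^×∕(𝒪_E∕ϖ^j)^×|`) and `vP vM` (the DEPTH-RULED counts at the tokens, E1 v1 §C: column `a = 0` all; off the diagonal `j − a = jl − m` the LOW cells; on it
LOW all and TOP `n∕φ` under the top bits), seven defining hypotheses, conclusion
`ε * Σ_{j<jl+1} Σ_{a<jl+2} q^a (vP j a − vM j a) = q^m * ((1 + (q+1)·Σ_{i<n_H} q^i) − 2·Σ_{i<S} q^i)`, `n_H = (jl + S − 2)∕2`, `S = d − d%2`, on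
`{ε = 1, m ≡ d (2), 1 ≤ m, m + d ≤ jl} ∪ {ε = −1, m = jl − d + 1, d ≤ jl}`, `jl` even, `d ≥ 2`, `q ≥ 2` — `ε` enters only through the token set and the sign of the conclusion.
PROOF = FILE 2 (`sumP_eval` − `sumM_eval`, `A0₊^{<d} − A0₋ = −q^{d−1}` by `alt_index_sum`, then `algebra_pos` ∕ `algebra_neg`).
HONEST LABEL.  Count-neutral (`--supports`); nothing printed is asserted; (ρ2b′-X) `stub_U2H_fixedPointCensus_typeTwo_unit0` (U2H :418) stays a PROVER TARGET (an empirical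
census law, kit-confirmed) until its payer lands; `HC_CM` is proved only modulo the 7 printed citations (2 remaining named inputs: hLiu418 = `stmt-HodgeConjecture-24832`, h413 =
`stmt-HodgeConjecture-24833`) until rung 0 closes.

## References
* [Kottwitz1986BaseChangeUnits] R. E. Kottwitz, *Base change for unit elements of Hecke algebras*, Compositio Math. 60 (1986), §1 pp. 240–241 (orbital integrals of units as
  lattice counts modulo the torus).
* [Rogawski1990] J. D. Rogawski, *Automorphic Representations of Unitary Groups in Three Variables*, Ann. of Math. Stud. 123 (1990), §4.9 Prop. 4.9.1 (b) p. 55, Lemma 4.9.3 p. 56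
  (the fixed-point census of a type-(2) element; the toric decomposition).
-/

set_option autoImplicit false

namespace Summit.HodgeConjecture.HodgeConjecture.Cruxes.H413.F0P3cDyRamToricCensusSumUnr

open Finset
open Summit.HodgeConjecture.HodgeConjecture.Cruxes.H413.F0P3cDyRamToricCensusSumUnrBlocks
open Summit.HodgeConjecture.HodgeConjecture.Cruxes.H413.F0P3cDyRamToricCensusSumUnrParts

/-- **O-SUM ∕ T5s, TYPE U («K∕F UNRAMIFIED») — THE TORIC CENSUS SUM.**  Let `nP nM : ℕ → ℕ → ℚ` follow the u-FREE LEVEL TABLES of type U (E1 v1 §B ∕ T5a v2 §2: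
`+` side `n₊(j,a) = (q²−1)q^{(j+a+d)∕2−2}` on `1 ≤ a ≤ j − d`, `a ≡ j − d (2)`, `n₊(j,0) = (q+1)q^{(j+d)∕2−1}` (`j ≥ d`) ∕ `G j` (`j < d`) for `j ≡ d (2)`; `−` side `n₋ = G j` on
`a = j + 1 − d` (`j ≥ d − 1`) and on `a = 0`, `j ≤ d − 2`, `j + d` odd; `G j = |(𝒪_M∕ϖ^j)^×∕(𝒪_E∕ϖ^j)^×| = (q+1)q^{j−1}`, `G 0 = 1`) and let `vP vM` follow the DEPTH RULES at the tokens
`(m, ε)` (E1 v1 §C ∕ T5a v2 §2b: column `a = 0` all; off the diagonal `j − a = jl − m` the LOW cells `2a ≤ m ∧ (j + a ≤ m ∨ j + a ≤ jl)`; on it the LOW cells all and the TOP cells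
`χ·n∕φ`, `φ₊ = (q−1)q^{⌈(2a−m)∕2⌉−1}`, `φ₋ = q^{⌊(2a−m)∕2⌋}`, `χ` = the TOP BITS `d + m ≤ jl ∧ j < jl` (`+`) ∕ `jl + 1 = d + m ∧ j < jl` (`−`) of T5a v3 — ε-free).  Then on the REALIZABLE token set
`{ε = +1, m ≡ d (2), 1 ≤ m ≤ jl − d} ∪ {ε = −1, m = jl − d + 1}` (`jl` even, `d ≥ 2`):
`ε·Σ_{j ≤ jl} Σ_{a} q^a (vP j a − vM j a) = q^m·(N_V − 2[S]_q)`, `N_V = 1 + (q+1)[n_H]_q`, `n_H = (jl + S − 2)∕2`, `S = d − d%2` — the O-Sum organ of the (ρ2b′-X) payer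
(`stub_U2H_fixedPointCensus_typeTwo_unit0`), type U.  Pure finite-sum bookkeeping over `ℚ` (no lattices): the `+` columns are geometric blocks on the parity rays `j = a + d + 2u`
plus the TOP diagonal `(q+1)q^{a+n_H}` (`⌊m∕2⌋ < a < m`), the `−` side one cell per row, `A0₊^{<d} − A0₋ = −q^{d−1}`, and the three `(q+1)`-blocks telescope.  Statement validated
against LH4-p14 (g3)'s census `osum_typeU_identity.v2` (500∕500 realizable tuples).
[cite: Kottwitz1986BaseChangeUnits, §1 pp. 240–241] [cite: Rogawski1990, §4.9 Prop. 4.9.1 (b) p. 55, Lemma 4.9.3 p. 56] -/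
theorem toricCensusSum_unr (q : ℕ) {d jl m : ℕ} (ε : ℚ) (hq : 2 ≤ q) (hd : 2 ≤ d) (hjl : jl % 2 = 0)
    (hreal : (ε = 1 ∧ m % 2 = d % 2 ∧ 1 ≤ m ∧ m + d ≤ jl) ∨ (ε = -1 ∧ m = jl - d + 1 ∧ d ≤ jl))
    (nP nM vP vM : ℕ → ℕ → ℚ)
    (hnP : ∀ j a, 1 ≤ a → nP j a = if a + d ≤ j ∧ (j - a - d) % 2 = 0 then ((q : ℚ) ^ 2 - 1) * (q : ℚ) ^ (j - 2 - (j - a - d) / 2) else 0)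
    (hnP0 : ∀ j, nP j 0 = if (j + d) % 2 = 0 then (if d ≤ j then ((q : ℚ) + 1) * (q : ℚ) ^ ((j + d) / 2 - 1) else (if j = 0 then 1 else ((q : ℚ) + 1) * (q : ℚ) ^ (j - 1))) else 0)
    (hnM : ∀ j a, nM j a = if (d ≤ j + 1 ∧ a + d = j + 1) ∨ (j + 1 < d ∧ a = 0 ∧ (j + d) % 2 = 1) then (if j = 0 then 1 else ((q : ℚ) + 1) * (q : ℚ) ^ (j - 1)) else 0)
    (hv0 : ∀ j, vP j 0 = nP j 0 ∧ vM j 0 = nM j 0)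
    (hvOff : ∀ j a, 1 ≤ a → j + m ≠ jl + a →
      (vP j a = if 2 * a ≤ m ∧ (j + a ≤ m ∨ j + a ≤ jl) then nP j a else 0) ∧ (vM j a = if 2 * a ≤ m ∧ (j + a ≤ m ∨ j + a ≤ jl) then nM j a else 0))
    (hvLow : ∀ j a, 1 ≤ a → j + m = jl + a → 2 * a ≤ m → vP j a = nP j a ∧ vM j a = nM j a)
    (hvTopP : ∀ j a, 1 ≤ a → j + m = jl + a → m < 2 * a →
      vP j a = if d + m ≤ jl ∧ j < jl then nP j a / (((q : ℚ) - 1) * (q : ℚ) ^ ((2 * a - m + 1) / 2 - 1)) else 0)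
    (hvTopM : ∀ j a, 1 ≤ a → j + m = jl + a → m < 2 * a →
      vM j a = if jl + 1 = d + m ∧ j < jl then nM j a / (q : ℚ) ^ ((2 * a - m) / 2) else 0) :
    ε * ∑ j ∈ range (jl + 1), ∑ a ∈ range (jl + 2), (q : ℚ) ^ a * (vP j a - vM j a) =
      (q : ℚ) ^ m * ((1 + ((q : ℚ) + 1) * ∑ i ∈ range ((jl + (d - d % 2) - 2) / 2), (q : ℚ) ^ i) - 2 * ∑ i ∈ range (d - d % 2), (q : ℚ) ^ i) := by
  have hx0 : (q : ℚ) ≠ 0 := Nat.cast_ne_zero.2 (by omega)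
  have hx1 : (q : ℚ) ≠ 1 := by exact_mod_cast (show q ≠ 1 by omega)
  -- the rows below the conductor: `A0₊^{<d} − A0₋ = −q^{d−1}`
  have hA0 : ∑ j ∈ range d, (if j % 2 = d % 2 then (if j = 0 then (1 : ℚ) else ((q : ℚ) + 1) * (q : ℚ) ^ (j - 1)) else 0) -
      ∑ j ∈ range d, (if j % 2 ≠ d % 2 then (if j = 0 then (1 : ℚ) else ((q : ℚ) + 1) * (q : ℚ) ^ (j - 1)) else 0) = -(q : ℚ) ^ (d - 1) := by
    rw [← Finset.sum_sub_distrib, ← alt_index_sum (q : ℚ) (by omega : 1 ≤ d)]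
    refine Finset.sum_congr rfl fun j _ => ?_
    by_cases h : j % 2 = d % 2
    · rw [if_pos h, if_neg (not_not.2 h), if_pos h]; ring
    · rw [if_neg h, if_pos h, if_neg h]; ring
  have hsplit : ∑ j ∈ range (jl + 1), ∑ a ∈ range (jl + 2), (q : ℚ) ^ a * (vP j a - vM j a) =
      ∑ j ∈ range (jl + 1), ∑ a ∈ range (jl + 2), (q : ℚ) ^ a * vP j a - ∑ j ∈ range (jl + 1), ∑ a ∈ range (jl + 2), (q : ℚ) ^ a * vM j a := by
    rw [← Finset.sum_sub_distrib]
    refine Finset.sum_congr rfl fun j _ => ?_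
    rw [← Finset.sum_sub_distrib]
    refine Finset.sum_congr rfl fun a _ => ?_
    ring
  rw [hsplit]
  rcases hreal with ⟨hε, hpar, hm1, hmd⟩ | ⟨hε, hmeq, hdjl⟩
  · subst hε
    rw [sumP_eval (q : ℚ) hx0 hx1 hd (by omega) (by omega) nP vP hnP hnP0 (fun j => (hv0 j).1) (fun j a ha hne => (hvOff j a ha hne).1)
        (fun j a ha he hl => (hvLow j a ha he hl).1) hvTopP,
      sumM_eval (q : ℚ) hx0 hd (by omega) (by omega) nM vM hnM (fun j => (hv0 j).2) (fun j a ha hne => (hvOff j a ha hne).2)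
        (fun j a ha he hl => (hvLow j a ha he hl).2) hvTopM,
      if_pos (show m + d ≤ jl ∧ (jl - m - d) % 2 = 0 from ⟨hmd, by omega⟩),
      if_neg (show ¬ (jl + 1 = d + m) from by omega),
      min_eq_left (by omega : m / 2 ≤ (jl - d) / 2), one_mul, add_zero]
    exact algebra_pos (q : ℚ) hx1 hd hpar hm1 hmd hjl _ _ hA0
  · subst hε
    rw [sumP_eval (q : ℚ) hx0 hx1 hd (by omega) (by omega) nP vP hnP hnP0 (fun j => (hv0 j).1) (fun j a ha hne => (hvOff j a ha hne).1)
        (fun j a ha he hl => (hvLow j a ha he hl).1) hvTopP,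
      sumM_eval (q : ℚ) hx0 hd (by omega) (by omega) nM vM hnM (fun j => (hv0 j).2) (fun j a ha hne => (hvOff j a ha hne).2)
        (fun j a ha he hl => (hvLow j a ha he hl).2) hvTopM,
      if_neg (show ¬ (m + d ≤ jl ∧ (jl - m - d) % 2 = 0) from fun h => by omega),
      if_pos (show jl + 1 = d + m from by omega)]
    exact algebra_neg (q : ℚ) hx1 hd hdjl hmeq hjl _ _ hA0

end Summit.HodgeConjecture.HodgeConjecture.Cruxes.H413.F0P3cDyRamToricCensusSumUnr
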